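import Summits.AtomisticToContinuum.Crystallization.Theorems.ThreeConeCertificateOnePercentCertificateFccWindow
import Summits.AtomisticToContinuum.Crystallization.Theorems.FrustratedLawDichotomySchurCutB

/-!
# FrustratedLawDichotomy · UP — the periodic energy ceiling `e(Q) ≤ −0.7175` IS A TREE THEOREM (bridge to the range-cut currency)

Every crux-by-name kernel of column 27623 in the range-cut / Schur-cut currency (`…RangeCut`, `…SchurCut(B)`, `…MotifDoor`,
`…PairPotentialDoor`, `…MotifDoorE`, `…TailFloor*`) carries the hypothesis
`hU : PeriodicEnergyCeiling (−(7175/10000))` («UP — IN THE TREE at eUp = −0.7175», lens-5 g33/g34).  This leaf module discharges it from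
the tree's certified fcc window `OnePercentFccWindow.energyPerParticle_fccPC_aW_le` (`e(fcc at nn-distance √0.943) ≤ −0.7175`; a
COMPUTATIONAL certificate: the 456 336-term lattice box sum is evaluated by `native_decide`, so everything here inherits the axiom
`Lean.ofReduceBool` on top of the whitelist — which is why this bridge lives in its OWN LEAF MODULE that no standard-axiom file imports).

[folklore] bookkeeping; 0 sorry.  Prover hand 1, gen 13 (decomp-a2c), `--supports stmt-AtomisticToContinuum-27623`.
-/

namespace Summit.AtomisticToContinuum.Crystallization.Theorems.FrustratedLawDichotomyPeriodicEnergyCeiling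

open Summit.AtomisticToContinuum.Crystallization.Theorems.FrustratedLawDichotomyRangeCut
open Summit.AtomisticToContinuum.Crystallization.Theorems.FrustratedLawDichotomySchurCut

/-- ★ **UP(−0.7175) HOLDS**: there is a periodic configuration of `ℝ³` (fcc at nearest-neighbour distance `√0.943`) with Lennard-Jones energy
per particle `≤ −0.7175` (computational, via `OnePercentFccWindow.energyPerParticle_fccPC_aW_le`). [folklore] -/
theorem periodicEnergyCeiling_holds : PeriodicEnergyCeiling (-(7175 / 10000)) :=
  ⟨_, OnePercentFccWindow.energyPerParticle_fccPC_aW_le⟩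

/-- `UP(eUp)` for every `eUp ≥ −0.7175`. [folklore] -/
theorem periodicEnergyCeiling_of_le {eUp : ℝ} (h : -(7175 / 10000) ≤ eUp) : PeriodicEnergyCeiling eUp := by
  obtain ⟨Q, hQ⟩ := periodicEnergyCeiling_holds
  exact ⟨Q, hQ.trans h⟩

-- (`e⋆ ≤ −0.7175` itself is the tree theorem `OnePercentFccWindow.eStar_le`; not restated here.)

/-! ## The Schur-cut kernels and the crux BY NAME with UP discharged -/

/-- **`FDG ⟸ SF ∧ T′♭(1/20, η₁; −0.7175, κ_T > 0) ∧ E′♭(1/20, η₁; −0.7175, κ_E > 0)`** — `fdg_of_split_schurCut` with UP discharged. [folklore] -/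
theorem fdg_of_split_schurCut' {η₁ : ℝ} {w ω : ℝ → ℝ} {A κT CT κE CE DE : ℝ} (h01 : (1 : ℝ) / 20 ≤ η₁) (hF : SchurFloor w ω A)
    (hκT : 0 < κT) (hT : SchurTopologicalPricing (1 / 20) η₁ w ω A (-(7175 / 10000)) κT CT)
    (hκE : 0 < κE) (hE : SchurElasticPricing (1 / 20) η₁ w ω A (-(7175 / 10000)) κE CE DE) : FDG :=
  fdg_of_split_schurCut h01 hF periodicEnergyCeiling_holds hκT hT hκE hE

/-- **`FDG ⟸ SF ∧ FRG♭(e₁ > −0.7175, C)`** — `fdg_of_schurCut` with UP discharged. [folklore] -/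
theorem fdg_of_schurCut' {w ω : ℝ → ℝ} {A e₁ C : ℝ} (hF : SchurFloor w ω A) (hG : SchurRangeGap w ω A e₁ C)
    (he : -(7175 / 10000) < e₁) : FDG :=
  fdg_of_schurCut hF periodicEnergyCeiling_holds hG he

/-- ★ **The crux at the RANGE-9/2 node of record with UP discharged**:
`MuEquilibriumDoor ∧ SF₄₅ ∧ T′♭₄₅(κ_T = 1/100, C_T) ∧ E′♭₄₅(κ_E = 1/1000, C_E, D_E) ⟹ AperiodicFrustratedLawGap`. [folklore chaining] -/
theorem aperiodicFrustratedLawGap_of_split_schurCut_fourHalf' {CT CE DE : ℝ}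
    (hDoor : Summit.AtomisticToContinuum.Crystallization.Theses.GrainCoreNetworkSplit.MuEquilibriumDoor) (hF : SF₄₅)
    (hT : SchurTopologicalPricing (1 / 20) (1 / 8) w₄₅ ω₄ (3 / 400) (-(7175 / 10000)) (1 / 100) CT)
    (hE : SchurElasticPricing (1 / 20) (1 / 8) w₄₅ ω₄ (3 / 400) (-(7175 / 10000)) (1 / 1000) CE DE) :
    Summit.AtomisticToContinuum.Crystallization.Theses.FrustratedLawDichotomy.AperiodicFrustratedLawGap :=
  aperiodicFrustratedLawGap_of_fdg hDoor (fdg_of_split_schurCut_fourHalf hF periodicEnergyCeiling_holds hT hE)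

/-- **The crux at the audited RANGE-5 twin with UP discharged**:
`MuEquilibriumDoor ∧ SF₅ ∧ T′♭₅(κ_T = 1/100, C_T) ∧ E′♭₅(κ_E = 1/1000, C_E, D_E) ⟹ AperiodicFrustratedLawGap`. [folklore chaining] -/
theorem aperiodicFrustratedLawGap_of_split_schurCut_five' {CT CE DE : ℝ}
    (hDoor : Summit.AtomisticToContinuum.Crystallization.Theses.GrainCoreNetworkSplit.MuEquilibriumDoor) (hF : SF₅)
    (hT : SchurTopologicalPricing (1 / 20) (1 / 8) w₅ ω₅ (13 / 4000) (-(7175 / 10000)) (1 / 100) CT)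
    (hE : SchurElasticPricing (1 / 20) (1 / 8) w₅ ω₅ (13 / 4000) (-(7175 / 10000)) (1 / 1000) CE DE) :
    Summit.AtomisticToContinuum.Crystallization.Theses.FrustratedLawDichotomy.AperiodicFrustratedLawGap :=
  aperiodicFrustratedLawGap_of_fdg hDoor (fdg_of_split_schurCut_five hF periodicEnergyCeiling_holds hT hE)

/-- **The unsplit crux form at range 9/2 with UP discharged**: `MuEquilibriumDoor ∧ SF₄₅ ∧ FRG♭₄₅(−0.7174, C) ⟹ AperiodicFrustratedLawGap`.
[folklore chaining] -/
theorem aperiodicFrustratedLawGap_of_schurCut_fourHalf' {C : ℝ}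
    (hDoor : Summit.AtomisticToContinuum.Crystallization.Theses.GrainCoreNetworkSplit.MuEquilibriumDoor) (hF : SF₄₅)
    (hG : SchurRangeGap w₄₅ ω₄ (3 / 400) (-(7174 / 10000)) C) :
    Summit.AtomisticToContinuum.Crystallization.Theses.FrustratedLawDichotomy.AperiodicFrustratedLawGap :=
  aperiodicFrustratedLawGap_of_fdg hDoor (fdg_of_schurCut_fourHalf hF periodicEnergyCeiling_holds hG)

/-- **The sibling `PeriodicFrustratedLawGap` (item 27624) with UP discharged** (generic Schur floor, `e₁ > −0.7175`). [folklore chaining] -/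
theorem periodicFrustratedLawGap_of_schurCut' {w ω : ℝ → ℝ} {A e₁ C : ℝ}
    (hDoor : Summit.AtomisticToContinuum.Crystallization.Theses.GrainCoreNetworkSplit.MuEquilibriumDoor)
    (hF : SchurFloor w ω A) (hG : SchurRangeGap w ω A e₁ C) (he : -(7175 / 10000) < e₁) :
    Summit.AtomisticToContinuum.Crystallization.Theses.FrustratedLawDichotomy.PeriodicFrustratedLawGap :=
  periodicFrustratedLawGap_of_schurCut hDoor hF periodicEnergyCeiling_holds hG he

end Summit.AtomisticToContinuum.Crystallization.Theorems.FrustratedLawDichotomyPeriodicEnergyCeiling
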